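import Summits.PneNP.PneNP.Theses.LatticeMagic
import Summits.PneNP.PneNP.Theses.ProofCplx
import Summits.PneNP.PneNP.Theorems.LatticeMagicTargetIffProofcplxThesis
import Summits.PneNP.PneNP.Theorems.LatticeMagicTargetIffNPneCoNP

/-!
# Crux `LatticeMagic.Target` (stmt-PneNP-10709) — lead c1 state file (2026-08-17)

`Target = ∃ c : ℝ, 1 ≤ c ∧ GapCVP_c ∉ PromiseCoNP`.

This file is the honest "skeleton" of the crux after three dead lines (Sketch, SketchIdeator5, AMGM):
the crux closes from exactly ONE open node, and that node is an EXISTING ledger item —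
stmt-PneNP-0097 (`¬ HasPolyBoundedProofSystem TAUT`, i.e. NP ≠ coNP, Cook–Reckhow) — verbatim.
`Target_of` composes the crux from it by the landed tree theorem
`latticeMagicTarget_of_proofcplxThesis` (p105441); `stub_iff_target` certifies that the node is also
NECESSARY (so no line can have a stub-conjunction weaker than it: cf.
`latticeMagicTarget_line_closure_proves_NP_ne_coNP`, p101056).

Nothing here is new mathematics; it is the kernel-checked form of the verdict `blocked-on: stmt-PneNP-0097`.
-/

set_option linter.dupNamespace false

namespace Summit.PneNP.PneNP.Cruxes.Target.LeadC1

open Literature.Computability.Complexity Literature.Computability.MetaComplexity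
open Summit.PneNP.PneNP.Theses.LatticeMagic (Target)
open Summit.PneNP.PneNP.Theses.ProofCplx (ProofcplxThesis)

/-- THE one open node of the crux: item stmt-PneNP-0097 verbatim (route ProofCplx's target
`ProofcplxThesis`; "TAUT has no polynomially bounded Cook–Reckhow proof system", i.e. NP ≠ coNP).
OPEN PROBLEM — not to be staffed from this crux; it is filed and staffed as stmt-PneNP-0097. -/
theorem stub_proofcplxThesis_0097 :
    ¬ Literature.Computability.MetaComplexity.HasPolyBoundedProofSystem
      Literature.Computability.Complexity.TAUT := by
  sorry

/-- Composition: the crux BY NAME from the single node, via the landed bridge (p105441). -/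
theorem Target_of : Summit.PneNP.PneNP.Theses.LatticeMagic.Target :=
  Summit.PneNP.PneNP.Theorems.latticeMagicTarget_of_proofcplxThesis stub_proofcplxThesis_0097

/-- The node is literally the definiens of `ProofcplxThesis` (stmt-PneNP-0097's route decl). -/
theorem stub_signature_is_0097 :
    ProofcplxThesis ↔
      ¬ Literature.Computability.MetaComplexity.HasPolyBoundedProofSystem
        Literature.Computability.Complexity.TAUT :=
  Iff.rfl

/-- Necessity: the node is EQUIVALENT to the crux (p105441), so every closing line's stub-conjunction
implies it; there is no admissible decomposition with all stubs strictly below it. -/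
theorem stub_iff_target :
    (¬ Literature.Computability.MetaComplexity.HasPolyBoundedProofSystem
        Literature.Computability.Complexity.TAUT) ↔ Target :=
  Summit.PneNP.PneNP.Theorems.latticeMagicTarget_iff_not_hasPolyBoundedProofSystem_TAUT.symm

/-- … and equivalent to `NP ≠ coNP` on the nose (p101056). -/
theorem target_iff_NP_ne_coNP' : Target ↔ Nondeterministic.NP ≠ coNP :=
  Summit.PneNP.PneNP.Theorems.latticeMagicTarget_iff_NP_ne_coNP

end Summit.PneNP.PneNP.Cruxes.Target.LeadC1
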